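import Literature.NumberTheory.ComplexMultiplication.CMOrderIdealClassMonoidFinite
import Literature.NumberTheory.ComplexMultiplication.CMOrderKummerDedekind
import Literature.LinearAlgebra.Matrix.LatimerMacDuffeeCorrespondence
import Mathlib.FieldTheory.Minpoly.IsIntegrallyClosed
import HarnessLib

/-!
# The monogenic order `ℤ[θ]` as an order of the series, and LATIMER–MACDUFFEE's finiteness: the classes of
# integer matrices with an irreducible characteristic polynomial `f` are as many as the ideal classes of `ℤ[θ]`

Family `hodge`, lane `lit-hodgefound` (Track 2 foundations library; seat p15, row g31-#5), topic
`Literature/NumberTheory/ComplexMultiplication`, namespace `Literature.NumberTheory.ComplexMultiplication` (the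
"arbitrary order" series `𝔯 = endOrder ρ ⊆ 𝒪_K`; here `ρ = Algebra.leftMulMatrix pb.basis` for a power basis
`pb = (1, θ, …, θⁿ⁻¹)` of the number field `K = ℚ(θ)` with `θ` integral, so that `endOrder ρ = ℤ[θ]`), with the
junction to `Literature/LinearAlgebra/Matrix/LatimerMacDuffeeCorrespondence.lean` (the abstract order
`AdjoinRoot f = ℤ[X]/(f)`).  THEOREMS ONLY: no definition, no instance, no notation, no named fact (net Literature
debt `0`).

## Sources, VERBATIM

P. Stevenhagen, *The arithmetic of number rings*, MSRI Publ. 44 (2008) [Stevenhagen2008NumberRings], §2 Thm. 2.2,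
p. 212: "A number ring `R ⊂ K` is an order in `K` if and only if it is of finite index in `𝒪_K`"; §7 (7-7),
p. 229: "`Δ(f) = [𝒪_K : ℤ[α]]² · Δ_K`" (the equation order `ℤ[α] = ℤ[X]/(f)` of a monic irreducible `f`).

C. G. Latimer, C. C. MacDuffee, *A correspondence between classes of ideals and classes of matrices*, Ann. of
Math. 34 (1933) 313–316 [LatimerMacduffee1933]; O. Taussky, Canad. J. Math. 1 (1949) 300–302 [Taussky1949],
p. 300: "there is a 1-1 correspondence between the classes of matrices `A` with rational integers as elements
which satisfy `f(A) = 0` and the ideal classes of the ring formed by the polynomials in `α`"; K. Iwaki, Topology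
Appl. 366 (2025) [Iwaki2025], §2.3 Thm. 2.18: "Suppose `f ∈ ℤ[x]` is a monic polynomial of degree `n` and
irreducible over `ℚ`. Let `θ` be a root of `f`. Then there is a bijection between `C(ℤ[θ])` and
`{A ∈ M(n;ℤ) | f(A) = O}/∼_S`."; M. H. Kim, S. Yamada, Kyungpook Math. J. 63 (2023) [KimYamada2023], §2.2
Thm. 2.13 («similarity classes of matrices whose characteristic polynomials are `g`») and §4 Thm. 4.4 (the
order `ℤ[Θₙ]` and its finitely many ideal classes, after [Stevenhagen2008NumberRings]).

S. Marseglia, *Computing the ideal class monoid of an order*, J. Lond. Math. Soc. 101 (2020) [Marseglia2019],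
§3 Def. 3.1 / Cor. 3.4 (`ICM(R) = 𝓘(R)/𝓟(R)` is finite), as formalised in `CMOrderIdealClassMonoidFinite`
(`EndOrder.finite_quot_fractionalIdeal`), whose docstring lists «the Latimer–MacDuffee–Taussky correspondence
with matrix classes» as NOT formalised — supplied here.

## What is formalised

For a number field `K`, a power basis `pb : PowerBasis ℚ K` whose generator `θ = pb.gen` is integral over `ℤ`,
`f = minpoly ℤ θ` (monic irreducible of degree `n = pb.dim = [K:ℚ]`) and `ρ = Algebra.leftMulMatrix pb.basis`:

* §1 `natDegree_minpoly_int_eq_dim`; **`span_int_range_basis_eq`** (`ℤ·1 ⊕ ⋯ ⊕ ℤθⁿ⁻¹ = ℤ[θ]`);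
  **`mem_endOrder_leftMulMatrix_basis_iff`** / `endOrder_leftMulMatrix_basis_eq` (`endOrder ρ = ℤ[θ]`: the
  multiplier ring of the lattice `ℤ[θ]` is `ℤ[θ]` itself — so the equation order IS an order of the series).
* §2 **`exists_ringEquiv_adjoinRoot_minpoly_endOrder`** (`ℤ[X]/(f) ≃+* endOrder ρ`, `X ↦ θ`).
* §3 `nonempty_quot_idealClass_equiv_of_ringEquiv` (ideal classes `αI = βJ` transported along a ring
  isomorphism), **`EndOrder.nonempty_quot_idealClass_equiv_quot_fractionalIdeal`** (for ANY order `𝔯 = endOrder ρ`: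
  the classes `αI = βJ` of nonzero integral ideals ≃ `ICM(𝔯)`, the classes `M = xN` of nonzero fractional
  ideals), `EndOrder.finite_quot_idealClass`.
* §4 **`finite_quot_charpoly_conj`** (LATIMER–MACDUFFEE: the `GLₙ(ℤ)`-conjugacy classes of integer matrices with
  characteristic polynomial `f` are FINITE in number) and
  **`natCard_quot_charpoly_conj_eq_natCard_quot_fractionalIdeal`** (their number is `#ICM(ℤ[θ])`), also with
  `f(A) = 0` in place of `χ_A = f` (`finite_quot_aeval_conj`, `natCard_quot_aeval_conj_eq_natCard_quot_fractionalIdeal`).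
* §5 from the polynomial alone (`f ∈ ℤ[X]` monic of degree `n ≥ 1`, `ℤ[X]/(f)` a domain; the number field
  `ℚ[X]/(f)` and its power basis are built inside the proof, GAUSS's lemma): **`finite_quot_idealClass_adjoinRoot`**
  (the ideal classes of `ℤ[X]/(f)` are finitely many), **`finite_quot_aeval_conj_of_isDomain`**,
  **`finite_quot_charpoly_conj_of_isDomain`** (finitely many `GLₙ(ℤ)`-classes of `n × n` integer matrices with
  `f(A) = 0`, resp. with characteristic polynomial `f`).
* §6 validation on the tree's `ℤ[2ζ₃] = ℤ[√-3] ⊂ ℚ(ζ₃)` (`#ICM = 2`): **`EisensteinTwo.natCard_quot_charpoly_conj_eq_two`**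
  — exactly two `GL₂(ℤ)`-classes of `2 × 2` integer matrices with characteristic polynomial `X² + 2X + 4`.
-/

open Polynomial

noncomputable section

open scoped nonZeroDivisors NumberField
open NumberField Module FractionalIdeal

namespace Literature.NumberTheory.ComplexMultiplication

/-! ### §1 `ℤ[θ] = ℤ·1 ⊕ ⋯ ⊕ ℤθⁿ⁻¹` is the order `endOrder (M_{(1, θ, …, θⁿ⁻¹)})` -/

section PowerBasisOrder

variable {K : Type} [Field K] [NumberField K] (pb : PowerBasis ℚ K) (hθ : IsIntegral ℤ pb.gen)

include hθ in
/-- For an integral generator `θ` of `K = ℚ(θ)`, `deg (minpoly_ℤ θ) = [K : ℚ]` (GAUSS: `minpoly_ℚ θ` is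
`minpoly_ℤ θ` read in `ℚ`). [cite: Stevenhagen2008NumberRings, §7 (7-7) (the equation order `ℤ[α]`), p. 229] -/
theorem natDegree_minpoly_int_eq_dim : (minpoly ℤ pb.gen).natDegree = pb.dim := by
  rw [← pb.natDegree_minpoly, minpoly.isIntegrallyClosed_eq_field_fractions' ℚ hθ,
    (minpoly.monic hθ).natDegree_map]

include hθ in
/-- **`ℤ·1 ⊕ ℤθ ⊕ ⋯ ⊕ ℤθⁿ⁻¹ = ℤ[θ]`**: the `ℤ`-span of the power basis of an integral generator is the ring
`ℤ[θ]` (every `θᵏ` reduces modulo the monic `minpoly_ℤ θ` of degree `n`). [cite: Stevenhagen2008NumberRings, §2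
Thm. 2.2 and §7 (7-7), pp. 212, 229] -/
theorem span_int_range_basis_eq :
    Submodule.span ℤ (Set.range pb.basis) = Subalgebra.toSubmodule (Algebra.adjoin ℤ {pb.gen}) := by
  apply le_antisymm
  · rw [Submodule.span_le]
    rintro _ ⟨i, rfl⟩
    rw [PowerBasis.coe_basis]
    exact Subalgebra.pow_mem _ (Algebra.self_mem_adjoin_singleton ℤ pb.gen) _
  · intro x hx
    rw [Subalgebra.mem_toSubmodule, Algebra.adjoin_singleton_eq_range_aeval, AlgHom.mem_range] at hx
    obtain ⟨p, rfl⟩ := hx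
    have hlt : (p %ₘ minpoly ℤ pb.gen).natDegree < pb.dim :=
      (natDegree_modByMonic_lt p (minpoly.monic hθ) (minpoly.ne_one ℤ pb.gen)).trans_eq
        (natDegree_minpoly_int_eq_dim pb hθ)
    change aeval pb.gen p ∈ Submodule.span ℤ (Set.range pb.basis)
    rw [← aeval_modByMonic_eq_self_of_root (p := p) (minpoly.aeval ℤ pb.gen), aeval_eq_sum_range' hlt]
    refine Submodule.sum_mem _ fun i hi ↦ Submodule.smul_mem _ _ (Submodule.subset_span ?_)
    exact ⟨⟨i, Finset.mem_range.1 hi⟩, by rw [PowerBasis.coe_basis]⟩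

include hθ in
/-- **The equation order is an order of the series: `endOrder (M_{(1, θ, …, θⁿ⁻¹)}) = ℤ[θ]`** — an element of
`K` multiplies the lattice `ℤ[θ]` into itself iff it lies in `ℤ[θ]` (`⟹`: apply to `1`; `⟸`: `ℤ[θ]` is a
ring). [cite: Stevenhagen2008NumberRings, §2 Thm. 2.2 («A number ring `R ⊂ K` is an order in `K` if and only if
it is of finite index in `𝒪_K`»), p. 212; §7 (7-7), p. 229] -/
theorem mem_endOrder_leftMulMatrix_basis_iff {x : K} :
    x ∈ endOrder (Algebra.leftMulMatrix pb.basis) ↔ x ∈ Algebra.adjoin ℤ {pb.gen} := by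
  rw [mem_endOrder_leftMulMatrix_iff]
  constructor
  · intro h
    have h0 := h ⟨0, pb.dim_pos⟩
    rw [span_int_range_basis_eq pb hθ, PowerBasis.coe_basis] at h0
    simpa only [pow_zero, mul_one, Subalgebra.mem_toSubmodule] using h0
  · intro hx j
    rw [span_int_range_basis_eq pb hθ, Subalgebra.mem_toSubmodule, PowerBasis.coe_basis]
    exact Subalgebra.mul_mem _ hx (Subalgebra.pow_mem _ (Algebra.self_mem_adjoin_singleton ℤ pb.gen) _)

include hθ in
/-- `endOrder (M_{(1, θ, …, θⁿ⁻¹)}) = ℤ[θ]` as subrings of `K`. [cite: Stevenhagen2008NumberRings, §2 Thm. 2.2,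
p. 212; §7 (7-7), p. 229] -/
theorem endOrder_leftMulMatrix_basis_eq :
    endOrder (Algebra.leftMulMatrix pb.basis) = (Algebra.adjoin ℤ {pb.gen}).toSubring :=
  Subring.ext fun _ ↦ by rw [mem_endOrder_leftMulMatrix_basis_iff pb hθ, Subalgebra.mem_toSubring]

/-! ### §2 `ℤ[X]/(f) ≃ ℤ[θ] = endOrder`, `f = minpoly_ℤ θ` -/

include hθ in
/-- **`ℤ[X]/(minpoly_ℤ θ) ≅ endOrder (M_{(1, θ, …, θⁿ⁻¹)})`, `X ↦ θ`**: evaluation at `θ` maps `ℤ[X]/(f)` onto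
`ℤ[θ] = endOrder`, injectively because `ℤ` is integrally closed (`minpoly_ℤ θ ∣ p` whenever `p(θ) = 0`).
[cite: Stevenhagen2008NumberRings, §7 (7-7) («`ℤ[α]`»), p. 229] [cite: KimYamada2023, §2.2 («`R = ℤ[Θ]` where
`Θ` is a root of a monic polynomial `g(x) ∈ ℤ[x]` which is irreducible»)] -/
theorem exists_ringEquiv_adjoinRoot_minpoly_endOrder :
    ∃ e : AdjoinRoot (minpoly ℤ pb.gen) ≃+* endOrder (Algebra.leftMulMatrix pb.basis),
      ∀ p : ℤ[X], ((e (AdjoinRoot.mk (minpoly ℤ pb.gen) p) : endOrder (Algebra.leftMulMatrix pb.basis)) : K) =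
        aeval pb.gen p := by
  have hev : (minpoly ℤ pb.gen).eval₂ (algebraMap ℤ K) pb.gen = 0 := by
    rw [← aeval_def]
    exact minpoly.aeval ℤ pb.gen
  set g₀ : AdjoinRoot (minpoly ℤ pb.gen) →+* K := AdjoinRoot.lift (algebraMap ℤ K) pb.gen hev with hg₀def
  have hg₀ : ∀ p, g₀ (AdjoinRoot.mk (minpoly ℤ pb.gen) p) = aeval pb.gen p := fun p ↦ by
    rw [hg₀def, AdjoinRoot.lift_mk, aeval_def]
  have hmem : ∀ y, g₀ y ∈ endOrder (Algebra.leftMulMatrix pb.basis) := fun y ↦ by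
    obtain ⟨p, rfl⟩ := AdjoinRoot.mk_surjective y
    rw [hg₀, mem_endOrder_leftMulMatrix_basis_iff pb hθ]
    exact aeval_mem_adjoin_singleton ℤ pb.gen
  let g : AdjoinRoot (minpoly ℤ pb.gen) →+* endOrder (Algebra.leftMulMatrix pb.basis) :=
    g₀.codRestrict (endOrder (Algebra.leftMulMatrix pb.basis)) hmem
  have hg : ∀ y, ((g y : endOrder (Algebra.leftMulMatrix pb.basis)) : K) = g₀ y := fun _ ↦ rfl
  refine ⟨RingEquiv.ofBijective g ⟨?_, ?_⟩, fun p ↦ by rw [RingEquiv.ofBijective_apply, hg, hg₀]⟩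
  · refine (injective_iff_map_eq_zero g).2 fun y hy ↦ ?_
    obtain ⟨p, rfl⟩ := AdjoinRoot.mk_surjective y
    have h0 : aeval pb.gen p = 0 := by
      rw [← hg₀, ← hg, hy]
      rfl
    exact AdjoinRoot.mk_eq_zero.2 (minpoly.isIntegrallyClosed_dvd hθ h0)
  · rintro ⟨x, hx⟩
    rw [mem_endOrder_leftMulMatrix_basis_iff pb hθ, Algebra.adjoin_singleton_eq_range_aeval,
      AlgHom.mem_range] at hx
    obtain ⟨p, rfl⟩ := hx
    exact ⟨AdjoinRoot.mk _ p, Subtype.ext (by rw [hg, hg₀])⟩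

end PowerBasisOrder

/-! ### §3 Ideal classes along a ring isomorphism; integral versus fractional ideal classes of an order -/

/-- **Ideal classes `αI = βJ` are transported along a ring isomorphism** (`I ↦ e(I)`).
[cite: Iwaki2025, §2.3 (the ideal class monoid `C(R)` of an integral domain)] -/
theorem nonempty_quot_idealClass_equiv_of_ringEquiv {R S : Type*} [CommRing R] [CommRing S] (e : R ≃+* S) :
    Nonempty (Quot (fun I J : {I : Ideal R // I ≠ ⊥} ↦
        ∃ x y : R, x ≠ 0 ∧ y ≠ 0 ∧ Ideal.span {x} * I.1 = Ideal.span {y} * J.1) ≃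
      Quot (fun I J : {I : Ideal S // I ≠ ⊥} ↦
        ∃ x y : S, x ≠ 0 ∧ y ≠ 0 ∧ Ideal.span {x} * I.1 = Ideal.span {y} * J.1)) := by
  have hmap : ∀ (x : R) (I : Ideal R),
      (Ideal.span {x} * I).map (e : R →+* S) = Ideal.span {e x} * I.map (e : R →+* S) := fun x I ↦ by
    rw [Ideal.map_mul, Ideal.map_span, Set.image_singleton]
    rfl
  have hmap' : ∀ (x : S) (J : Ideal S),
      (Ideal.span {x} * J).map (e.symm : S →+* R) = Ideal.span {e.symm x} * J.map (e.symm : S →+* R) :=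
    fun x J ↦ by
    rw [Ideal.map_mul, Ideal.map_span, Set.image_singleton]
    rfl
  have hne : ∀ {I : Ideal R}, I ≠ ⊥ → I.map (e : R →+* S) ≠ ⊥ := fun {I} hI h ↦
    hI ((Ideal.map_eq_bot_iff_of_injective e.injective).1 h)
  have hne' : ∀ {J : Ideal S}, J ≠ ⊥ → J.map (e.symm : S →+* R) ≠ ⊥ := fun {J} hJ h ↦
    hJ ((Ideal.map_eq_bot_iff_of_injective e.symm.injective).1 h)
  let ε : {I : Ideal R // I ≠ ⊥} ≃ {I : Ideal S // I ≠ ⊥} :=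
    { toFun := fun I ↦ ⟨I.1.map (e : R →+* S), hne I.2⟩
      invFun := fun J ↦ ⟨J.1.map (e.symm : S →+* R), hne' J.2⟩
      left_inv := fun I ↦ Subtype.ext (Ideal.map_of_equiv (I := I.1) e)
      right_inv := fun J ↦ Subtype.ext (by
        have h := Ideal.map_of_equiv (I := J.1) e.symm
        rwa [RingEquiv.symm_symm] at h) }
  refine ⟨Quot.congr ε fun I J ↦ ⟨?_, ?_⟩⟩
  · rintro ⟨x, y, hx, hy, h⟩
    refine ⟨e x, e y, (map_ne_zero_iff _ e.injective).2 hx, (map_ne_zero_iff _ e.injective).2 hy, ?_⟩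
    change Ideal.span {e x} * I.1.map (e : R →+* S) = Ideal.span {e y} * J.1.map (e : R →+* S)
    rw [← hmap, ← hmap, h]
  · rintro ⟨x, y, hx, hy, h⟩
    refine ⟨e.symm x, e.symm y, (map_ne_zero_iff _ e.symm.injective).2 hx,
      (map_ne_zero_iff _ e.symm.injective).2 hy, ?_⟩
    change Ideal.span {x} * I.1.map (e : R →+* S) = Ideal.span {y} * J.1.map (e : R →+* S) at h
    have h' := congrArg (Ideal.map (e.symm : S →+* R)) h
    rwa [hmap', hmap', Ideal.map_of_equiv, Ideal.map_of_equiv] at h'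

namespace EndOrder

variable {K : Type} [Field K] [NumberField K]
variable {ι : Type} [Fintype ι] [DecidableEq ι] {ρ : K →ₐ[ℚ] Matrix ι ι ℚ}
variable [IsFractionRing (endOrder ρ) K]

/-- **Integral and fractional ideal classes of an order agree**: for `𝔯 = endOrder ρ`, `I ↦ ↑I` induces a
bijection from the classes `αI = βJ` of nonzero ideals `I ⊆ 𝔯` onto `ICM(𝔯)`, the classes `M = xN` (`x ∈ K^×`)
of nonzero fractional ideals (every fractional ideal is `a⁻¹·𝔞` for an integral `𝔞`, Mathlib's
`FractionalIdeal.exists_eq_spanSingleton_mul`; `(x)I = (y)J` iff `↑I = (y/x)·↑J`). [cite: Marseglia2019, §3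
Def. 3.1 and Cor. 3.4 («`ICM(R) = 𝓘(R)/𝓟(R)`»), p. 6] [cite: Iwaki2025, §2.3 (the relation `αI = βJ`)] -/
theorem nonempty_quot_idealClass_equiv_quot_fractionalIdeal :
    Nonempty (Quot (fun I J : {I : Ideal (endOrder ρ) // I ≠ ⊥} ↦
        ∃ x y : endOrder ρ, x ≠ 0 ∧ y ≠ 0 ∧ Ideal.span {x} * I.1 = Ideal.span {y} * J.1) ≃
      Quot (fun M N : {M : FractionalIdeal (endOrder ρ)⁰ K // M ≠ 0} ↦
        ∃ x : K, x ≠ 0 ∧ (M : FractionalIdeal (endOrder ρ)⁰ K) = spanSingleton (endOrder ρ)⁰ x * N)) := by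
  classical
  have hinj : Function.Injective (algebraMap (endOrder ρ) K) := IsFractionRing.injective (endOrder ρ) K
  -- (1) `(x)I = (y)J` ⟹ `↑I = (x⁻¹y)·↑J`
  have h1 : ∀ {I J : Ideal (endOrder ρ)} {x y : endOrder ρ}, x ≠ 0 → y ≠ 0 →
      Ideal.span {x} * I = Ideal.span {y} * J →
      (I : FractionalIdeal (endOrder ρ)⁰ K) =
        spanSingleton (endOrder ρ)⁰ ((algebraMap (endOrder ρ) K x)⁻¹ * algebraMap (endOrder ρ) K y) * J := by
    intro I J x y hx hy h
    have hx' : algebraMap (endOrder ρ) K x ≠ 0 := (map_ne_zero_iff _ hinj).2 hx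
    have h' := congrArg (fun L : Ideal (endOrder ρ) ↦ (L : FractionalIdeal (endOrder ρ)⁰ K)) h
    simp only [coeIdeal_mul, coeIdeal_span_singleton] at h'
    rw [← spanSingleton_mul_spanSingleton, mul_assoc, ← h', ← mul_assoc, spanSingleton_mul_spanSingleton,
      inv_mul_cancel₀ hx', spanSingleton_one, one_mul]
  -- (2) `↑I = z·↑J`, `z ≠ 0` ⟹ `(b)I = (a)J` for `z = a/b`
  have h2 : ∀ {I J : Ideal (endOrder ρ)} {z : K}, z ≠ 0 →
      (I : FractionalIdeal (endOrder ρ)⁰ K) = spanSingleton (endOrder ρ)⁰ z * J →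
      ∃ x y : endOrder ρ, x ≠ 0 ∧ y ≠ 0 ∧ Ideal.span {x} * I = Ideal.span {y} * J := by
    intro I J z hz h
    obtain ⟨a, b, hb, hab⟩ := IsFractionRing.div_surjective (A := endOrder ρ) z
    have hb0 : b ≠ 0 := nonZeroDivisors.ne_zero hb
    have hb' : algebraMap (endOrder ρ) K b ≠ 0 := (map_ne_zero_iff _ hinj).2 hb0
    have ha0 : a ≠ 0 := by
      rintro rfl
      rw [map_zero, zero_div] at hab
      exact hz hab.symm
    refine ⟨b, a, hb0, ha0, (coeIdeal_inj (K := K)).1 ?_⟩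
    rw [coeIdeal_mul, coeIdeal_span_singleton, coeIdeal_mul, coeIdeal_span_singleton, h, ← mul_assoc,
      spanSingleton_mul_spanSingleton, ← hab, mul_div_cancel₀ _ hb']
  -- the map `[I] ↦ [↑I]` and its inverse through integral representatives
  let φ : Quot (fun I J : {I : Ideal (endOrder ρ) // I ≠ ⊥} ↦
        ∃ x y : endOrder ρ, x ≠ 0 ∧ y ≠ 0 ∧ Ideal.span {x} * I.1 = Ideal.span {y} * J.1) →
      Quot (fun M N : {M : FractionalIdeal (endOrder ρ)⁰ K // M ≠ 0} ↦
        ∃ x : K, x ≠ 0 ∧ (M : FractionalIdeal (endOrder ρ)⁰ K) = spanSingleton (endOrder ρ)⁰ x * N) :=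
    Quot.lift (fun I ↦ Quot.mk _ ⟨(I.1 : FractionalIdeal (endOrder ρ)⁰ K), coeIdeal_ne_zero.2 I.2⟩)
      fun I J ⟨x, y, hx, hy, h⟩ ↦ Quot.sound ⟨_, mul_ne_zero (inv_ne_zero ((map_ne_zero_iff _ hinj).2 hx))
        ((map_ne_zero_iff _ hinj).2 hy), h1 hx hy h⟩
  have hrep : ∀ M : {M : FractionalIdeal (endOrder ρ)⁰ K // M ≠ 0},
      ∃ I : {I : Ideal (endOrder ρ) // I ≠ ⊥}, ∃ x : K, x ≠ 0 ∧
        (M.1 : FractionalIdeal (endOrder ρ)⁰ K) = spanSingleton (endOrder ρ)⁰ x * (I.1 : FractionalIdeal (endOrder ρ)⁰ K) :=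
    fun M ↦ by
      obtain ⟨a, aI, ha, hM⟩ := exists_eq_spanSingleton_mul M.1
      have haI : aI ≠ ⊥ := by
        rintro rfl
        rw [coeIdeal_bot, mul_zero] at hM
        exact M.2 hM
      exact ⟨⟨aI, haI⟩, _, inv_ne_zero ((map_ne_zero_iff _ hinj).2 ha), hM⟩
  choose ψ₀ xψ hxψ hψ using hrep
  -- `↑ψ₀M = (xψ M)⁻¹·M`
  have h3 : ∀ M : {M : FractionalIdeal (endOrder ρ)⁰ K // M ≠ 0},
      ((ψ₀ M).1 : FractionalIdeal (endOrder ρ)⁰ K) = spanSingleton (endOrder ρ)⁰ (xψ M)⁻¹ * M.1 := fun M ↦ by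
    rw [hψ M, ← mul_assoc, spanSingleton_mul_spanSingleton, inv_mul_cancel₀ (hxψ M), spanSingleton_one, one_mul]
  let ψ : Quot (fun M N : {M : FractionalIdeal (endOrder ρ)⁰ K // M ≠ 0} ↦
        ∃ x : K, x ≠ 0 ∧ (M : FractionalIdeal (endOrder ρ)⁰ K) = spanSingleton (endOrder ρ)⁰ x * N) →
      Quot (fun I J : {I : Ideal (endOrder ρ) // I ≠ ⊥} ↦
        ∃ x y : endOrder ρ, x ≠ 0 ∧ y ≠ 0 ∧ Ideal.span {x} * I.1 = Ideal.span {y} * J.1) :=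
    Quot.lift (fun M ↦ Quot.mk _ (ψ₀ M)) fun M N ⟨z, hz, hMN⟩ ↦ Quot.sound <| by
      -- `↑ψ₀M = (xψ M)⁻¹·M = (xψ M)⁻¹ z (xψ N)·↑ψ₀N`
      refine h2 (z := (xψ M)⁻¹ * z * xψ N) (mul_ne_zero (mul_ne_zero (inv_ne_zero (hxψ M)) hz) (hxψ N)) ?_
      rw [h3 M, hMN, hψ N, ← mul_assoc, ← mul_assoc, spanSingleton_mul_spanSingleton,
        spanSingleton_mul_spanSingleton]
  refine ⟨{ toFun := φ, invFun := ψ, left_inv := ?_, right_inv := ?_ }⟩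
  · rintro ⟨I⟩
    change Quot.mk _ (ψ₀ ⟨(I.1 : FractionalIdeal (endOrder ρ)⁰ K), _⟩) = Quot.mk _ I
    exact Quot.sound (h2 (inv_ne_zero (hxψ _)) (h3 ⟨(I.1 : FractionalIdeal (endOrder ρ)⁰ K), coeIdeal_ne_zero.2 I.2⟩))
  · rintro ⟨M⟩
    change Quot.mk _ ⟨((ψ₀ M).1 : FractionalIdeal (endOrder ρ)⁰ K), _⟩ = Quot.mk _ M
    exact Quot.sound ⟨(xψ M)⁻¹, inv_ne_zero (hxψ M), h3 M⟩

variable [Nonempty ι] in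
/-- **The ideal classes `αI = βJ` of the nonzero ideals of ANY order `𝔯 = endOrder ρ` are finitely many**
(`= #ICM(𝔯)`, finite by `CMOrderIdealClassMonoidFinite`). [cite: Marseglia2019, §3 Cor. 3.4 and §5, pp. 6, 10]
[cite: KimYamada2023, §4 Thm. 4.4 (orders, after Stevenhagen)] -/
theorem finite_quot_idealClass :
    Finite (Quot (fun I J : {I : Ideal (endOrder ρ) // I ≠ ⊥} ↦
      ∃ x y : endOrder ρ, x ≠ 0 ∧ y ≠ 0 ∧ Ideal.span {x} * I.1 = Ideal.span {y} * J.1)) := by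
  obtain ⟨e⟩ := nonempty_quot_idealClass_equiv_quot_fractionalIdeal (ρ := ρ) (K := K)
  haveI := finite_quot_fractionalIdeal (ρ := ρ) (K := K)
  exact Finite.of_equiv _ e.symm

end EndOrder

/-! ### §4 LATIMER–MACDUFFEE: finitely many classes of matrices with characteristic polynomial `f`, `#ICM(ℤ[θ])` of them -/

section LatimerMacDuffee

variable {K : Type} [Field K] [NumberField K] (pb : PowerBasis ℚ K) (hθ : IsIntegral ℤ pb.gen)

include hθ in
/-- **LATIMER–MACDUFFEE–TAUSSKY meets the order `ℤ[θ] = endOrder (M_{(1, θ, …, θⁿ⁻¹)})`: the number of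
`GLₙ(ℤ)`-classes of `n × n` integer matrices `A` with `f(A) = 0`, `f = minpoly_ℤ θ`, is `#ICM(ℤ[θ])`** — the
number of classes `M = xN` of nonzero fractional ideals of the order (as `Nat.card`; both sides finite by
`finite_quot_aeval_conj`). [cite: Taussky1949, p. 300 and Theorems 1–4] [cite: LatimerMacduffee1933]
[cite: Iwaki2025, §2.3 Thm. 2.18] [cite: Marseglia2019, §3 Def. 3.1 / Cor. 3.4, p. 6] -/
theorem natCard_quot_aeval_conj_eq_natCard_quot_fractionalIdeal
    [IsFractionRing (endOrder (Algebra.leftMulMatrix pb.basis)) K] :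
    Nat.card (Quot (fun A B : {A : Matrix (Fin pb.dim) (Fin pb.dim) ℤ // aeval A (minpoly ℤ pb.gen) = 0} ↦
        ∃ P : Matrix (Fin pb.dim) (Fin pb.dim) ℤ, IsUnit P.det ∧ P * A.1 = B.1 * P)) =
      Nat.card (Quot (fun M N : {M : FractionalIdeal (endOrder (Algebra.leftMulMatrix pb.basis))⁰ K // M ≠ 0} ↦
        ∃ x : K, x ≠ 0 ∧ (M : FractionalIdeal (endOrder (Algebra.leftMulMatrix pb.basis))⁰ K) =
          spanSingleton (endOrder (Algebra.leftMulMatrix pb.basis))⁰ x * N)) := by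
  haveI : Fact (minpoly ℤ pb.gen).Monic := ⟨minpoly.monic hθ⟩
  haveI : IsDomain (AdjoinRoot (minpoly ℤ pb.gen)) :=
    AdjoinRoot.isDomain_of_prime (minpoly.prime_of_isIntegrallyClosed hθ)
  obtain ⟨e, -⟩ := exists_ringEquiv_adjoinRoot_minpoly_endOrder pb hθ
  obtain ⟨e₁⟩ := nonempty_quot_idealClass_equiv_of_ringEquiv e
  obtain ⟨e₂⟩ := EndOrder.nonempty_quot_idealClass_equiv_quot_fractionalIdeal
    (ρ := Algebra.leftMulMatrix pb.basis) (K := K)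
  rw [Literature.LinearAlgebra.Matrix.natCard_quot_conj_eq_natCard_quot_idealClass
    (natDegree_minpoly_int_eq_dim pb hθ) pb.dim_pos.ne', Nat.card_congr (e₁.trans e₂)]

include hθ in
/-- **LATIMER–MACDUFFEE's finiteness: the integer matrices `A` with `f(A) = 0` (`f = minpoly_ℤ θ`, irreducible of
degree `n = [ℚ(θ):ℚ]`) fall into FINITELY many `GLₙ(ℤ)`-conjugacy classes** — as many as the ideal classes of
the order `ℤ[θ]`, which are finitely many («an order is of finite index in `𝒪_K`», DADE–TAUSSKY–ZASSENHAUS /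
`CMOrderIdealClassMonoidFinite`). [cite: LatimerMacduffee1933] [cite: Taussky1949, p. 300] [cite: KimYamada2023,
§2.2 Thm. 2.13 and §4 Thm. 4.4] -/
theorem finite_quot_aeval_conj :
    Finite (Quot (fun A B : {A : Matrix (Fin pb.dim) (Fin pb.dim) ℤ // aeval A (minpoly ℤ pb.gen) = 0} ↦
      ∃ P : Matrix (Fin pb.dim) (Fin pb.dim) ℤ, IsUnit P.det ∧ P * A.1 = B.1 * P)) := by
  haveI : Fact (minpoly ℤ pb.gen).Monic := ⟨minpoly.monic hθ⟩
  haveI : IsDomain (AdjoinRoot (minpoly ℤ pb.gen)) :=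
    AdjoinRoot.isDomain_of_prime (minpoly.prime_of_isIntegrallyClosed hθ)
  haveI := isFractionRing_endOrder (Algebra.leftMulMatrix pb.basis)
  haveI : Nonempty (Fin pb.dim) := ⟨⟨0, pb.dim_pos⟩⟩
  obtain ⟨e, -⟩ := exists_ringEquiv_adjoinRoot_minpoly_endOrder pb hθ
  obtain ⟨Φ, -⟩ := Literature.LinearAlgebra.Matrix.exists_equiv_quot_conj_quot_idealClass
    (f := minpoly ℤ pb.gen) (natDegree_minpoly_int_eq_dim pb hθ) pb.dim_pos.ne'
  obtain ⟨e₁⟩ := nonempty_quot_idealClass_equiv_of_ringEquiv e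
  haveI := EndOrder.finite_quot_idealClass (ρ := Algebra.leftMulMatrix pb.basis) (K := K)
  exact Finite.of_equiv _ (Φ.trans e₁).symm

include hθ in
/-- **LATIMER–MACDUFFEE, characteristic-polynomial form: the similarity classes of integer matrices whose
characteristic polynomial is the irreducible `f = minpoly_ℤ θ` are FINITE in number** (KIM–YAMADA's setting:
«similarity classes of matrices whose characteristic polynomials are `g`» ↔ `C(ℤ[Θ])`, finite).
[cite: KimYamada2023, §2.2 Thm. 2.13 and §4 Thm. 4.4] [cite: LatimerMacduffee1933] -/
theorem finite_quot_charpoly_conj :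
    Finite (Quot (fun A B : {A : Matrix (Fin pb.dim) (Fin pb.dim) ℤ // A.charpoly = minpoly ℤ pb.gen} ↦
      ∃ P : Matrix (Fin pb.dim) (Fin pb.dim) ℤ, IsUnit P.det ∧ P * A.1 = B.1 * P)) := by
  haveI : Fact (minpoly ℤ pb.gen).Monic := ⟨minpoly.monic hθ⟩
  haveI : IsDomain (AdjoinRoot (minpoly ℤ pb.gen)) :=
    AdjoinRoot.isDomain_of_prime (minpoly.prime_of_isIntegrallyClosed hθ)
  haveI := finite_quot_aeval_conj pb hθ
  let ε : {A : Matrix (Fin pb.dim) (Fin pb.dim) ℤ // A.charpoly = minpoly ℤ pb.gen} ≃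
      {A : Matrix (Fin pb.dim) (Fin pb.dim) ℤ // aeval A (minpoly ℤ pb.gen) = 0} :=
    Equiv.subtypeEquivRight fun A ↦
      (Literature.LinearAlgebra.Matrix.aeval_eq_zero_iff_charpoly_eq
        (natDegree_minpoly_int_eq_dim pb hθ) pb.dim_pos.ne' A).symm
  let η : Quot (fun A B : {A : Matrix (Fin pb.dim) (Fin pb.dim) ℤ // A.charpoly = minpoly ℤ pb.gen} ↦
        ∃ P : Matrix (Fin pb.dim) (Fin pb.dim) ℤ, IsUnit P.det ∧ P * A.1 = B.1 * P) ≃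
      Quot (fun A B : {A : Matrix (Fin pb.dim) (Fin pb.dim) ℤ // aeval A (minpoly ℤ pb.gen) = 0} ↦
        ∃ P : Matrix (Fin pb.dim) (Fin pb.dim) ℤ, IsUnit P.det ∧ P * A.1 = B.1 * P) :=
    Quot.congr ε fun _ _ ↦ Iff.rfl
  exact Finite.of_equiv _ η.symm

include hθ in
/-- **The number of similarity classes of integer matrices with characteristic polynomial `f = minpoly_ℤ θ` is
`#ICM(ℤ[θ])`.** [cite: KimYamada2023, §2.2 Thm. 2.13] [cite: Iwaki2025, §2.3 Thm. 2.18] [cite: Marseglia2019, §3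
Cor. 3.4, p. 6] -/
theorem natCard_quot_charpoly_conj_eq_natCard_quot_fractionalIdeal
    [IsFractionRing (endOrder (Algebra.leftMulMatrix pb.basis)) K] :
    Nat.card (Quot (fun A B : {A : Matrix (Fin pb.dim) (Fin pb.dim) ℤ // A.charpoly = minpoly ℤ pb.gen} ↦
        ∃ P : Matrix (Fin pb.dim) (Fin pb.dim) ℤ, IsUnit P.det ∧ P * A.1 = B.1 * P)) =
      Nat.card (Quot (fun M N : {M : FractionalIdeal (endOrder (Algebra.leftMulMatrix pb.basis))⁰ K // M ≠ 0} ↦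
        ∃ x : K, x ≠ 0 ∧ (M : FractionalIdeal (endOrder (Algebra.leftMulMatrix pb.basis))⁰ K) =
          spanSingleton (endOrder (Algebra.leftMulMatrix pb.basis))⁰ x * N)) := by
  haveI : Fact (minpoly ℤ pb.gen).Monic := ⟨minpoly.monic hθ⟩
  haveI : IsDomain (AdjoinRoot (minpoly ℤ pb.gen)) :=
    AdjoinRoot.isDomain_of_prime (minpoly.prime_of_isIntegrallyClosed hθ)
  rw [← natCard_quot_aeval_conj_eq_natCard_quot_fractionalIdeal pb hθ]
  let ε : {A : Matrix (Fin pb.dim) (Fin pb.dim) ℤ // A.charpoly = minpoly ℤ pb.gen} ≃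
      {A : Matrix (Fin pb.dim) (Fin pb.dim) ℤ // aeval A (minpoly ℤ pb.gen) = 0} :=
    Equiv.subtypeEquivRight fun A ↦
      (Literature.LinearAlgebra.Matrix.aeval_eq_zero_iff_charpoly_eq
        (natDegree_minpoly_int_eq_dim pb hθ) pb.dim_pos.ne' A).symm
  let η : Quot (fun A B : {A : Matrix (Fin pb.dim) (Fin pb.dim) ℤ // A.charpoly = minpoly ℤ pb.gen} ↦
        ∃ P : Matrix (Fin pb.dim) (Fin pb.dim) ℤ, IsUnit P.det ∧ P * A.1 = B.1 * P) ≃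
      Quot (fun A B : {A : Matrix (Fin pb.dim) (Fin pb.dim) ℤ // aeval A (minpoly ℤ pb.gen) = 0} ↦
        ∃ P : Matrix (Fin pb.dim) (Fin pb.dim) ℤ, IsUnit P.det ∧ P * A.1 = B.1 * P) :=
    Quot.congr ε fun _ _ ↦ Iff.rfl
  exact Nat.card_congr η

end LatimerMacDuffee

/-! ### §5 From the polynomial: `f ∈ ℤ[X]` monic with `ℤ[X]/(f)` a domain -/

section FromPolynomial

variable {n : ℕ} {f : ℤ[X]} [Fact f.Monic] [IsDomain (AdjoinRoot f)]

/-- **The ideal classes `αI = βJ` of the equation order `ℤ[X]/(f)` are FINITE in number** for every monic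
`f ∈ ℤ[X]` with `ℤ[X]/(f)` an integral domain (i.e. `f` irreducible): inside the number field `K = ℚ[X]/(f)`
(irreducible over `ℚ` by GAUSS's lemma) the root `θ` is integral with `minpoly_ℤ θ = f`, so `ℤ[X]/(f) ≅ ℤ[θ]` is
the order `endOrder (M_{(1, θ, …, θⁿ⁻¹)})` of §1–§2, whose ideal classes are finitely many (§3).
[cite: Stevenhagen2008NumberRings, §2 Thm. 2.2 and §7 (7-7), pp. 212, 229] [cite: KimYamada2023, §4 Thm. 4.4
(«`C(ℤ[Θₙ])`»)] [cite: Marseglia2019, §3 Cor. 3.4, p. 6] -/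
theorem finite_quot_idealClass_adjoinRoot :
    Finite (Quot (fun I J : {I : Ideal (AdjoinRoot f) // I ≠ ⊥} ↦
      ∃ x y : AdjoinRoot f, x ≠ 0 ∧ y ≠ 0 ∧ Ideal.span {x} * I.1 = Ideal.span {y} * J.1)) := by
  classical
  have hf : f.Monic := Fact.out
  have hprime : Prime f := (Ideal.span_singleton_prime hf.ne_zero).1
    ((Ideal.Quotient.isDomain_iff_prime _).1 (inferInstanceAs (IsDomain (AdjoinRoot f))))
  -- the number field `K = ℚ[X]/(f) = ℚ(θ)`
  have hirrQ : Irreducible (f.map (algebraMap ℤ ℚ)) :=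
    (hf.irreducible_iff_irreducible_map_fraction_map (K := ℚ)).1 hprime.irreducible
  haveI : Fact (Irreducible (f.map (algebraMap ℤ ℚ))) := ⟨hirrQ⟩
  set pb : PowerBasis ℚ (AdjoinRoot (f.map (algebraMap ℤ ℚ))) := AdjoinRoot.powerBasis hirrQ.ne_zero with hpb
  have hgen : pb.gen = AdjoinRoot.root (f.map (algebraMap ℤ ℚ)) := by rw [hpb, AdjoinRoot.powerBasis_gen]
  have hθ0 : aeval pb.gen f = 0 := by
    rw [hgen, aeval_def, show algebraMap ℤ (AdjoinRoot (f.map (algebraMap ℤ ℚ))) =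
        (AdjoinRoot.of (f.map (algebraMap ℤ ℚ))).comp (algebraMap ℤ ℚ) from RingHom.ext_int _ _,
      ← eval₂_map, AdjoinRoot.eval₂_root]
  have hθ : IsIntegral ℤ pb.gen := ⟨f, hf, by rwa [← aeval_def]⟩
  -- `minpoly_ℤ θ = f`
  have hmin : minpoly ℤ pb.gen = f :=
    eq_of_monic_of_associated (minpoly.monic hθ) hf
      ((minpoly.prime_of_isIntegrallyClosed hθ).irreducible.associated_of_dvd hprime.irreducible
        (minpoly.isIntegrallyClosed_dvd hθ hθ0))
  -- `ℤ[X]/(f) ≅ ℤ[θ] = endOrder`, whose ideal classes are finitely many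
  obtain ⟨e, -⟩ := exists_ringEquiv_adjoinRoot_minpoly_endOrder pb hθ
  let e₀ : AdjoinRoot f ≃+* AdjoinRoot (minpoly ℤ pb.gen) :=
    Ideal.quotEquivOfEq (congrArg (fun g : ℤ[X] ↦ (Ideal.span {g} : Ideal ℤ[X])) hmin.symm)
  haveI : Nonempty (Fin pb.dim) := ⟨⟨0, pb.dim_pos⟩⟩
  haveI := isFractionRing_endOrder (Algebra.leftMulMatrix pb.basis)
  haveI := EndOrder.finite_quot_idealClass (ρ := Algebra.leftMulMatrix pb.basis)
    (K := AdjoinRoot (f.map (algebraMap ℤ ℚ)))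
  obtain ⟨e₁⟩ := nonempty_quot_idealClass_equiv_of_ringEquiv (e₀.trans e)
  exact Finite.of_equiv _ e₁.symm

/-- **LATIMER–MACDUFFEE's finiteness from the polynomial: for `f ∈ ℤ[X]` monic of degree `n ≥ 1` with
`ℤ[X]/(f)` a domain, the `n × n` integer matrices `A` with `f(A) = 0` fall into FINITELY many `GLₙ(ℤ)`-classes**
(the LATIMER–MACDUFFEE–TAUSSKY bijection with the finitely many ideal classes of `ℤ[X]/(f)`).
[cite: LatimerMacduffee1933] [cite: Taussky1949, p. 300 and Theorems 1–4] [cite: Iwaki2025, §2.3 Thm. 2.18] -/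
theorem finite_quot_aeval_conj_of_isDomain (hdeg : f.natDegree = n) (hn : n ≠ 0) :
    Finite (Quot (fun A B : {A : Matrix (Fin n) (Fin n) ℤ // aeval A f = 0} ↦
      ∃ P : Matrix (Fin n) (Fin n) ℤ, IsUnit P.det ∧ P * A.1 = B.1 * P)) := by
  obtain ⟨Φ, -⟩ := Literature.LinearAlgebra.Matrix.exists_equiv_quot_conj_quot_idealClass (f := f) hdeg hn
  haveI := finite_quot_idealClass_adjoinRoot (f := f)
  exact Finite.of_equiv _ Φ.symm

/-- **LATIMER–MACDUFFEE's finiteness, characteristic-polynomial form: the similarity classes of `n × n` integer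
matrices whose characteristic polynomial is a given `f` (monic of degree `n ≥ 1`, `ℤ[X]/(f)` a domain) are
FINITE in number.** [cite: LatimerMacduffee1933] [cite: KimYamada2023, §2.2 Thm. 2.13] [cite: Iwaki2025, §2.3
Thm. 2.18] -/
theorem finite_quot_charpoly_conj_of_isDomain (hdeg : f.natDegree = n) (hn : n ≠ 0) :
    Finite (Quot (fun A B : {A : Matrix (Fin n) (Fin n) ℤ // A.charpoly = f} ↦
      ∃ P : Matrix (Fin n) (Fin n) ℤ, IsUnit P.det ∧ P * A.1 = B.1 * P)) := by
  obtain ⟨Φ, -⟩ :=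
    Literature.LinearAlgebra.Matrix.exists_equiv_quot_charpoly_conj_quot_idealClass (f := f) hdeg hn
  haveI := finite_quot_idealClass_adjoinRoot (f := f)
  exact Finite.of_equiv _ Φ.symm

end FromPolynomial

/-! ### §6 Validation: exactly two classes of `2 × 2` integer matrices with characteristic polynomial `X² + 2X + 4` -/

namespace CMTypeLattice.EisensteinTwo

/-- **LATIMER–MACDUFFEE on the tree's order `ℤ[2ζ₃] = ℤ[√-3] = endOrder (M_{(1, 2ζ₃)})`: there are exactly TWO
`GL₂(ℤ)`-classes of `2 × 2` integer matrices with characteristic polynomial `X² + 2X + 4 = minpoly_ℤ(2ζ₃)`** — as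
many as the ideal classes `#ICM(ℤ[√-3]) = 2` (`CMOrderIdealClassMonoidFinite.natCard_quot_fractionalIdeal_eq_two`:
the principal class and the class of `𝔭₂ = (2, 1 + √-3)`); the power basis `(1, 2ζ₃)` of `ℚ(ζ₃)` IS the tree's
`EisensteinTwo.basis`. [cite: LatimerMacduffee1933] [cite: Taussky1949, p. 300] [cite: Stevenhagen2008NumberRings,
§6 Example 6.9 («the order `R = ℤ[√-3]` of index 2»), p. 226] [cite: Marseglia2019, §3 Cor. 3.4, p. 6] -/
theorem natCard_quot_charpoly_conj_eq_two :
    Nat.card (Quot (fun A B : {A : Matrix (Fin 2) (Fin 2) ℤ // A.charpoly = X ^ 2 + 2 * X + 4} ↦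
      ∃ P : Matrix (Fin 2) (Fin 2) ℤ, IsUnit P.det ∧ P * A.1 = B.1 * P)) = 2 := by
  -- Mathlib's extra `ℤ`-algebra structure `CyclotomicField.instAlgebra` on `K₃ = CyclotomicField 3 ℚ` competes with
  -- the canonical `Ring.toIntAlgebra` used by the general theorems (cf. `CMOrderConductor` §5); pin the canonical one.
  letI : Algebra ℤ K₃ := Ring.toIntAlgebra K₃
  -- the power basis `(1, 2ζ₃)` with `pb.basis = EisensteinTwo.basis`
  let pb : PowerBasis ℚ K₃ :=
    { gen := 2 * zeta
      dim := 2
      basis := basis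
      basis_eq_pow := fun i ↦ by
        fin_cases i
        · simp [basis_zero]
        · simp [basis_one] }
  have hgen : pb.gen = ((twoZeta : endOrder (Algebra.leftMulMatrix basis)) : K₃) := rfl
  have hθ : IsIntegral ℤ pb.gen := by
    have h := isIntegral_int_add_int_mul_zeta 0 2
    simpa using h
  have hmin : minpoly ℤ pb.gen = X ^ 2 + 2 * X + 4 := by
    rw [hgen, ← minpoly_twoZeta]
    exact minpoly.algebraMap_eq (IsFractionRing.injective (endOrder (Algebra.leftMulMatrix basis)) K₃) twoZeta
  have key := natCard_quot_charpoly_conj_eq_natCard_quot_fractionalIdeal pb hθ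
  rw [hmin] at key
  exact key.trans natCard_quot_fractionalIdeal_eq_two

end CMTypeLattice.EisensteinTwo

end Literature.NumberTheory.ComplexMultiplication
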